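import Mathlib
import Summits.Ventures.PercRepro2.Star3Row

/-!
# THE THREE-PIN STAR IN THE SUPPORT GRAPH (blind cell PercRepro2, night-1 g27; proofs/NIGHT1-G27.md §3)

The class of Star3Main.lean / Star3Row.lean asked of the LITERAL graph (`a₃` has exactly the three edges
`g = {a₃, o}`, `e = {a₃, a₁}`, `d = {a₃, a₂}`); here the same with every OTHER edge at `a₃` of weight `0`
(`hstar : ∀ e', a₃ ∈ ends e' → e' ≠ g → e' ≠ e → e' ≠ d → p e' = 0`), through g23's support transport
(`nMixChord_normDZ_restrict_iff`, `nMixChord_normDZ2_restrict_iff`, `HCov_restrict_iff`): `starSupport3 ends a₃ g e d`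
= the edges that are not «at `a₃` and different from `g`, `e`, `d`», on which the star is literal
(`star3_restrict`).  **`dzChord_o_edge_of_three_pin_star_support`**, **`HCov_three_pin_star_support`**,
**`dz2Chord_o_edge_of_three_pin_star_support`**, and the root mirrors `…₂…`.  Own code (from g24's
MixChordOStarSupport.lean pattern); standard axioms.
-/

namespace Summit.Ventures.PercRepro2

open UnionCluster CovForm

namespace Mix

open OStar

namespace OStar3

open Support

section SupportStar

open scoped Classical in
/-- The edges that are not «at `a₃` and different from `g`, `e`, `d`». -/
noncomputable def starSupport3 {V : Type*} {E : Type*} [Fintype E] (ends : E → Sym2 V) (a₃ : V) (g e d : E) :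
    Finset E :=
  Finset.univ.filter fun e' => ¬ (a₃ ∈ ends e' ∧ e' ≠ g ∧ e' ≠ e ∧ e' ≠ d)

variable {V : Type*} {E : Type*} [Fintype E] [DecidableEq E] [Fintype V] [DecidableEq V] {R : Type*}
  [Field R] [LinearOrder R] [IsStrictOrderedRing R]

variable (p : E → R) (ends : E → Sym2 V) {o a₁ a₂ a₃ : V} (b : V) {f g e d : E}

omit [DecidableEq E] [Fintype V] [DecidableEq V] [Field R] [LinearOrder R] [IsStrictOrderedRing R] in
/-- Membership in `starSupport3`. -/
lemma mem_starSupport3 {e' : E} :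
    e' ∈ starSupport3 ends a₃ g e d ↔ ¬ (a₃ ∈ ends e' ∧ e' ≠ g ∧ e' ≠ e ∧ e' ≠ d) := by
  classical
  simp [starSupport3]

omit [DecidableEq E] [Fintype V] [DecidableEq V] [LinearOrder R] [IsStrictOrderedRing R] in
/-- Every edge off `starSupport3` has weight `0` under the support-star hypothesis. -/
lemma starSupport3_zero (hstar : ∀ e', a₃ ∈ ends e' → e' ≠ g → e' ≠ e → e' ≠ d → p e' = 0) :
    ∀ e', e' ∉ starSupport3 ends a₃ g e d → p e' = 0 := by
  intro e' he'
  rw [mem_starSupport3, not_not] at he'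
  exact hstar e' he'.1 he'.2.1 he'.2.2.1 he'.2.2.2

omit [DecidableEq E] [Fintype V] [DecidableEq V] [Field R] [LinearOrder R] [IsStrictOrderedRing R] in
/-- `g` lies in the star support. -/
lemma g_mem_starSupport3 : g ∈ starSupport3 ends a₃ g e d := by
  rw [mem_starSupport3]
  exact fun h => h.2.1 rfl

omit [DecidableEq E] [Fintype V] [DecidableEq V] [Field R] [LinearOrder R] [IsStrictOrderedRing R] in
/-- `e` lies in the star support. -/
lemma e_mem_starSupport3 : e ∈ starSupport3 ends a₃ g e d := by
  rw [mem_starSupport3]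
  exact fun h => h.2.2.1 rfl

omit [DecidableEq E] [Fintype V] [DecidableEq V] [Field R] [LinearOrder R] [IsStrictOrderedRing R] in
/-- `d` lies in the star support. -/
lemma d_mem_starSupport3 : d ∈ starSupport3 ends a₃ g e d := by
  rw [mem_starSupport3]
  exact fun h => h.2.2.2 rfl

omit [DecidableEq E] [Fintype V] [DecidableEq V] [Field R] [LinearOrder R] [IsStrictOrderedRing R] in
/-- An `o`-edge `{o, x}` with `x ≠ a₃` lies in the star support. -/
lemma o_edge_mem_starSupport3 {x : V} (hf : ends f = s(o, x)) (ho : o ≠ a₃) (h3x : a₃ ≠ x) :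
    f ∈ starSupport3 ends a₃ g e d := by
  rw [mem_starSupport3]
  rintro ⟨h, -⟩
  rw [hf, Sym2.mem_iff] at h
  rcases h with h | h
  · exact ho h.symm
  · exact h3x h

omit [DecidableEq E] [Fintype V] [DecidableEq V] [Field R] [LinearOrder R] [IsStrictOrderedRing R] in
/-- In the restricted graph the star is literal: `g`, `e`, `d` are the only edges at `a₃`. -/
lemma star3_restrict :
    ∀ e' : {e' // e' ∈ starSupport3 ends a₃ g e d},
      a₃ ∈ restrictEnds (starSupport3 ends a₃ g e d) ends e' →
        e' = ⟨g, g_mem_starSupport3 ends⟩ ∨ e' = ⟨e, e_mem_starSupport3 ends⟩ ∨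
          e' = ⟨d, d_mem_starSupport3 ends⟩ := by
  intro e' he'
  have h := (mem_starSupport3 ends).1 e'.2
  by_cases h1 : e' = ⟨g, g_mem_starSupport3 ends⟩
  · exact Or.inl h1
  · by_cases h2 : e' = ⟨e, e_mem_starSupport3 ends⟩
    · exact Or.inr (Or.inl h2)
    · refine Or.inr (Or.inr ?_)
      by_contra h3
      exact h ⟨he', fun hg => h1 (Subtype.ext hg), fun he => h2 (Subtype.ext he), fun hd => h3 (Subtype.ext hd)⟩

/-- **The three-pin star in the support graph: the `D·Z`-chord along `{o, a₁}`** (every other edge at `a₃`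
of weight `0`). -/
theorem dzChord_o_edge_of_three_pin_star_support (hp : IsProbVec p) (hf : ends f = s(o, a₁))
    (hg : ends g = s(a₃, o)) (he : ends e = s(a₃, a₁)) (hd : ends d = s(a₃, a₂))
    (hstar : ∀ e', a₃ ∈ ends e' → e' ≠ g → e' ≠ e → e' ≠ d → p e' = 0)
    (h12 : a₁ ≠ a₂) (h13 : a₁ ≠ a₃) (h23 : a₂ ≠ a₃) (ho1 : o ≠ a₁) (ho2 : o ≠ a₂) (ho3 : o ≠ a₃)
    (hb3 : b ≠ a₃) :
    NMixChord (normDZ ends a₁ a₂ a₃) p ends o a₁ a₂ a₃ b f := by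
  have hS := starSupport3_zero p ends hstar
  have hfS := o_edge_mem_starSupport3 ends (g := g) (e := e) (d := d) hf ho3 h13.symm
  rw [nMixChord_normDZ_restrict_iff _ hS ends o a₁ a₂ a₃ b hfS]
  have hg' : restrictEnds (starSupport3 ends a₃ g e d) ends ⟨g, g_mem_starSupport3 ends⟩ = s(a₃, o) := hg
  have he' : restrictEnds (starSupport3 ends a₃ g e d) ends ⟨e, e_mem_starSupport3 ends⟩ = s(a₃, a₁) := he
  have hd' : restrictEnds (starSupport3 ends a₃ g e d) ends ⟨d, d_mem_starSupport3 ends⟩ = s(a₃, a₂) := hd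
  exact dzChord_o_edge_of_three_pin_star _ _ b (isProbVec_restrict p _ hp) hf hg' he' hd' (star3_restrict ends)
    h12 h13 h23 ho1 ho2 ho3 hb3

/-- **(HCOV) on the three-pin star in the support graph.** -/
theorem HCov_three_pin_star_support (hp : IsProbVec p) (hg : ends g = s(a₃, o)) (he : ends e = s(a₃, a₁))
    (hd : ends d = s(a₃, a₂)) (hstar : ∀ e', a₃ ∈ ends e' → e' ≠ g → e' ≠ e → e' ≠ d → p e' = 0)
    (h12 : a₁ ≠ a₂) (h13 : a₁ ≠ a₃) (h23 : a₂ ≠ a₃) (ho3 : o ≠ a₃) (hb3 : b ≠ a₃) :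
    HCov p ends o a₁ a₂ a₃ b := by
  have hS := starSupport3_zero p ends hstar
  rw [HCov_restrict_iff _ hS ends o a₁ a₂ a₃ b]
  have hg' : restrictEnds (starSupport3 ends a₃ g e d) ends ⟨g, g_mem_starSupport3 ends⟩ = s(a₃, o) := hg
  have he' : restrictEnds (starSupport3 ends a₃ g e d) ends ⟨e, e_mem_starSupport3 ends⟩ = s(a₃, a₁) := he
  have hd' : restrictEnds (starSupport3 ends a₃ g e d) ends ⟨d, d_mem_starSupport3 ends⟩ = s(a₃, a₂) := hd
  exact HCov_three_pin_star _ _ b (isProbVec_restrict p _ hp) hg' he' hd' (star3_restrict ends) h12 h13 h23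
    ho3 hb3

/-- **The chain's row on the three-pin star in the support graph** (`NMixChord normDZ2` along `{o, a₁}`). -/
theorem dz2Chord_o_edge_of_three_pin_star_support (hp : IsProbVec p) (hf : ends f = s(o, a₁))
    (hg : ends g = s(a₃, o)) (he : ends e = s(a₃, a₁)) (hd : ends d = s(a₃, a₂))
    (hstar : ∀ e', a₃ ∈ ends e' → e' ≠ g → e' ≠ e → e' ≠ d → p e' = 0)
    (h12 : a₁ ≠ a₂) (h13 : a₁ ≠ a₃) (h23 : a₂ ≠ a₃) (ho1 : o ≠ a₁) (ho2 : o ≠ a₂) (ho3 : o ≠ a₃)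
    (hb3 : b ≠ a₃) :
    NMixChord (normDZ2 ends a₁ a₂ a₃) p ends o a₁ a₂ a₃ b f :=
  nMixChord_DZ2_of_DZ hp
    (dzChord_o_edge_of_three_pin_star_support p ends b hp hf hg he hd hstar h12 h13 h23 ho1 ho2 ho3 hb3)
    (HCov_three_pin_star_support (Function.update p f 0) ends b (hp.update f le_rfl zero_le_one) hg he hd
      (fun e' h3 hg' he' hd' => by
        rw [Function.update_of_ne]
        · exact hstar e' h3 hg' he' hd'
        · intro hef
          rw [hef, hf, Sym2.mem_iff] at h3
          rcases h3 with h | h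
          · exact ho3 h.symm
          · exact h13 h.symm)
      h12 h13 h23 ho3 hb3)

/-- **The three-pin star in the support graph at the root `a₂`: the `D·Z`-chord along `{o, a₂}`.** -/
theorem dzChord_o_edge₂_of_three_pin_star_support (hp : IsProbVec p) (hf : ends f = s(o, a₂))
    (hg : ends g = s(a₃, o)) (he : ends e = s(a₃, a₁)) (hd : ends d = s(a₃, a₂))
    (hstar : ∀ e', a₃ ∈ ends e' → e' ≠ g → e' ≠ e → e' ≠ d → p e' = 0)
    (h12 : a₁ ≠ a₂) (h13 : a₁ ≠ a₃) (h23 : a₂ ≠ a₃) (ho1 : o ≠ a₁) (ho2 : o ≠ a₂) (ho3 : o ≠ a₃)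
    (hb3 : b ≠ a₃) :
    NMixChord (normDZ ends a₁ a₂ a₃) p ends o a₁ a₂ a₃ b f := by
  have hS := starSupport3_zero p ends hstar
  have hfS := o_edge_mem_starSupport3 ends (g := g) (e := e) (d := d) hf ho3 h23.symm
  rw [nMixChord_normDZ_restrict_iff _ hS ends o a₁ a₂ a₃ b hfS]
  have hg' : restrictEnds (starSupport3 ends a₃ g e d) ends ⟨g, g_mem_starSupport3 ends⟩ = s(a₃, o) := hg
  have he' : restrictEnds (starSupport3 ends a₃ g e d) ends ⟨e, e_mem_starSupport3 ends⟩ = s(a₃, a₁) := he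
  have hd' : restrictEnds (starSupport3 ends a₃ g e d) ends ⟨d, d_mem_starSupport3 ends⟩ = s(a₃, a₂) := hd
  exact dzChord_o_edge₂_of_three_pin_star _ _ b (isProbVec_restrict p _ hp) hf hg' he' hd'
    (star3_restrict ends) h12 h13 h23 ho1 ho2 ho3 hb3

/-- **The chain's row on the three-pin star in the support graph at the root `a₂`.** -/
theorem dz2Chord_o_edge₂_of_three_pin_star_support (hp : IsProbVec p) (hf : ends f = s(o, a₂))
    (hg : ends g = s(a₃, o)) (he : ends e = s(a₃, a₁)) (hd : ends d = s(a₃, a₂))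
    (hstar : ∀ e', a₃ ∈ ends e' → e' ≠ g → e' ≠ e → e' ≠ d → p e' = 0)
    (h12 : a₁ ≠ a₂) (h13 : a₁ ≠ a₃) (h23 : a₂ ≠ a₃) (ho1 : o ≠ a₁) (ho2 : o ≠ a₂) (ho3 : o ≠ a₃)
    (hb3 : b ≠ a₃) :
    NMixChord (normDZ2 ends a₁ a₂ a₃) p ends o a₁ a₂ a₃ b f :=
  nMixChord_DZ2_of_DZ hp
    (dzChord_o_edge₂_of_three_pin_star_support p ends b hp hf hg he hd hstar h12 h13 h23 ho1 ho2 ho3 hb3)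
    (HCov_three_pin_star_support (Function.update p f 0) ends b (hp.update f le_rfl zero_le_one) hg he hd
      (fun e' h3 hg' he' hd' => by
        rw [Function.update_of_ne]
        · exact hstar e' h3 hg' he' hd'
        · intro hef
          rw [hef, hf, Sym2.mem_iff] at h3
          rcases h3 with h | h
          · exact ho3 h.symm
          · exact h23 h.symm)
      h12 h13 h23 ho3 hb3)

end SupportStar

end OStar3

end Mix

end Summit.Ventures.PercRepro2
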